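import Summits.FinalStateConjecture.FinalStateConjecture.Theses.ZeroEnergyKerrOrBomb
import Summits.FinalStateConjecture.FinalStateConjecture.Theses.AnalyticityInvadesErgoregion
import Literature.Geometry.Lorentzian.CausalityOpennessProofs
import Literature.Geometry.Lorentzian.LeviCivitaLocality
import Literature.Geometry.Lorentzian.LeviCivita
import Literature.Geometry.Lorentzian.MullerZumHagenAnalyticity
import Literature.Geometry.Lorentzian.FlowInvariantFunctions
import Literature.Geometry.Lorentzian.DocStructureTimeFunction
import Literature.Geometry.Lorentzian.DocProductStructure
import Literature.Geometry.Lorentzian.NomizuKillingExtension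
import Literature.Geometry.Lorentzian.NomizuKillingExtensionProofs
import Literature.Geometry.Lorentzian.ChartwiseAnalyticity
import Literature.Geometry.Lorentzian.KillingFieldLocalExtension
import Literature.Geometry.Lorentzian.KerrRadiusConditionalPseudoconvexity
import Mathlib.Analysis.Normed.Module.Connected
-- LANDED stubs of the crux called BY NAME (shared with line `azimuthal-partial-analyticity`):
import Summits.FinalStateConjecture.FinalStateConjecture.Theorems.ZeroEnergyKerrOrBombNonTrappingHawkingRigidityStubInvariantKillingSubcollar
import Summits.FinalStateConjecture.FinalStateConjecture.Theorems.ZeroEnergyKerrOrBombNonTrappingHawkingRigidityStubSlabPatching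
import Summits.FinalStateConjecture.FinalStateConjecture.Theorems.ZeroEnergyKerrOrBombNonTrappingHawkingRigidityStubPointContinuationAnalytic
import Summits.FinalStateConjecture.FinalStateConjecture.Theorems.ZeroEnergyKerrOrBombNonTrappingHawkingRigidityStubInvariantRadialFunctionConnected
-- Negative lemma of the crux (Disproof F1), imported as a scratch check that no stub is an instance of it:
import Summits.FinalStateConjecture.FinalStateConjecture.Theorems.NonTrappingHawkingRigidity.Negative.KillingNonvanishingOfIPlusRegular

/-!
# Line `zero-energy-convex-sweep` — crux `NonTrappingHawkingRigidity` (stmt-FinalStateConjecture-13896)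
# — crux-STRATEGIST alternative line (planner-cstrat-…-13896-s2-0, 2026-08-17), rev 1

Registered ALONGSIDE the live line `azimuthal-partial-analyticity` (lead a1, rev 8; its engine N3
`stub_azimuthalCascade` was handed back as promote-stub, crux-sized).  It never touches that skeleton: it
REUSES its kernel-checked Zorn composition (copied below, attributed) and calls the same four LANDED stubs by
name (S1a p139503, S1b₇ p162333, S2a p154819, S3 p139035), and it REPLACES the whole analytic feed
(S2 two-variable Tataru system UCP — unprinted; N1 far seed + N1b three bets; N2 Hörmander bound — unstatable;
N3 azimuthal cascade — new mathematics) by the engine the ROUTE THESIS itself names first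
("T-conditional Carleman sweeps (this card)", `Theses/ZeroEnergyKerrOrBomb.lean` § WHY THIS LINE) and which no
line of this crux has used so far:

* **S2c `stub_conditionalCarlemanContinuation` (IN PRINT, fact VENDORED):** Ionescu–Klainerman's
  `T`-CONDITIONAL local extension of Killing fields commuting with `T` across a strictly `T`-null-convex
  hypersurface of a Ricci-flat metric (Surveys Diff. Geom. 20 (2015) Thm 2.4 with Def. 2.2 / Lemma 2.17 =
  JAMS 26 (2013) Thm 1.2 + the conditional Carleman weights of Invent. Math. 175 (2009) §3, carried out in
  AIK, CMP 299 (2010) §§4–5).  The chart form is ALREADY a named fact of the tree,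
  `Literature.Geometry.Lorentzian.IonescuKlainermanConditionalLocalExtension` (`KillingFieldLocalExtension.lean`),
  consumed by the sibling crux `GapExhaustion`'s line `photon-shell-pseudoconvexity` with ~60 landed bridging
  files (Finsler lemma, Lorentz normalisation, Killing coordinate bridge, pull-back/push-forward of fields).
  The stub is its manifold transcription at ONE supported point of the d.o.c.: `PointContinuationAt` from
  `NonNullSupportAt` + local `T`-invariance of `f` + strict `T`-null-convexity of the level at `q`
  (`IsTNullConvexAt`).  Size L–XL of bookkeeping, provable now modulo the fact (precedent: S2a landed in one wave).
* **G1 `stub_convexRadialFunction` (THE BET, the AIK programme's "ingredient 2"):** under the crux's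
  telescope (h1–h16 verbatim) and given the structural radial function `ρ₀` of S1b ((R1)–(R6)), there is a
  radial function `ρ` ((R1)–(R6)) with SPACELIKE gradient on the closed ergoregion and whose levels are
  STRICTLY `T`-NULL-CONVEX towards `{ρ < ρ q}` at every belt point `q` off the collar `U`
  (`Hess ρ (X, X) < 0` for `X ≠ 0` null, `g(X, T) = 0`, `dρ(X) = 0`).  On every sub-extremal Kerr exterior
  `ρ = r − r₊` works and the convexity clause is KERNEL-CHECKED in the tree
  (`Kerr.hessAt_radius_neg_of_ksEnergy_eq_zero`, `KerrRadiusConditionalPseudoconvexity.lean`: `2Σ² Hess r(w,w)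
  = R′ = −2(r − M)(L² + Q) < 0` at zero energy — the same computation as the route's closed support item
  `KerrNoZeroEnergyTrapping`).  In print it is exactly the missing global ingredient of Alexakis–Ionescu–
  Klainerman (CMP 2010 Lemma 4.3 obtains it for `y = Re (1 − σ_T)⁻¹` from Mars–Simon smallness; Duke 163
  (2014) Prop. 1.3 makes it void by swallowing the ergoregion into the local-rigidity neighbourhood for small
  `g(T,T)|_{S₀}`; IK 2015 §4: the non-trapping conjecture).  h16 is necessary for it (a `T`-null-convex
  exhaustion of the belt forbids zero-energy rays trapped mod `T`: `ρ ∘ γ` has no interior local minimum and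
  an ω-limit inside a level is excluded by strictness), NOT known to be sufficient ("exposedness does not follow
  from non-trapping in general Riemannian optics", TRIAGE 10690 r1-2 (b); in 2-D Riemannian optics it DOES:
  Betelú–Gulliver–Littman 2002 / Paternain–Salo–Uhlmann–Zhou 2019, held book Paternain–Salo–Uhlmann 2023
  p. 274).  The prover's canonical candidate is the IK radial function `y_T = Re (1 − σ_T)⁻¹` of the Ernst
  potential of `T` (twist potential exists on the simply connected d.o.c.: the ONE use of h5), glued to `ρ₀`
  near `𝓔⁺` and near infinity; the refuter's target is G1 WITHOUT h1 (a smooth stationary NON-vacuum belt with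
  Γ₀ = ∅ mod `T` and no `T`-null-convex radial exhaustion would show that vacuum must enter the geometry of the
  sweep itself, not only the Carleman step).
* **D′ `stub_carlemanLineDebts`:** the four named facts the line consumes, by name —
  `chruscielCosta2008_equivariantTimeFunction` (S1a), `mullerZumHagen1970_analytic_of_timelikeKilling` (S2a at
  `T`-timelike / collar points: Disproof (F5) honoured — vacuum IS used on `{g(T,T) < 0} ∖ U`),
  `chruscielCosta2008_docProductStructure` (S1b₇), `IonescuKlainermanConditionalLocalExtension` (S2c).
  (Nomizu's theorem is DISCHARGED in the tree: `PseudoRiemannianMetric.Nomizu1960_killing_extension_holds`.)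

Composition (sorry-free, §4–§5): S1b₇ (landed) ⇒ `ρ₀`; G1 ⇒ `ρ` with spacelike gradient on the closed
ergoregion + belt convexity; S1a (landed) + `sweep_of_radial` ⇒ anchored sub-collar field `K₀` and timelike sweep
`(U', ρ, c₀)`; Zorn on anchored partial continuations (rev-4 architecture of `Lines/Sketch.lean`, verbatim from
`Lines/azimuthal_partial_analyticity.lean` rev 8 §4): a maximal element of finite level `c` is strictly extended
because every level point `q` admits a one-step continuation — by S2a (landed; MzH analyticity + local Nomizu)
if `g(T,T)(q) < 0` or `q ∈ U`, by S2c (IK `T`-conditional Carleman) at belt points off `U`, where G1 supplies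
`IsTNullConvexAt` and the sweep supplies `NonNullSupportAt` and `T`-invariance — and S3 (landed) patches the
pointwise continuations to a slab; level `⊤`; docking on `U' ∩ U''`.  NO far seed, NO non-rotating dichotomy,
NO surface gravity, NO corridor / reach / coherence bets, NO passage through `𝓗⁺`: the sweep runs outward from
the collar and the far `T`-timelike region is swept like any other level (pseudo-convexity void / analyticity).

WHY IT DODGES THE STUCK GOAL of the live line.  N3 is stuck on MANUFACTURING two-variable analyticity of the
unknown metric at belt points (three unprinted analytic inputs + gauge bets G1′/G4).  Here nothing about the
regularity class of `g` is manufactured: the UCP input is the printed `C^∞` Carleman theorem, and the only open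
statement is a property of ONE scalar function against the zero-energy null directions of the GIVEN metric —
finite-dimensional pointwise inequalities along a compact-mod-`T` set, checkable on any explicit stationary
metric (kit), true with margin on Kerr (kernel), `C²`-open (so the whole AIK CMP-2010 perturbative regime and
the Duke-2014 slow-rotation regime are sub-cases where G1 is a theorem in print).

Disproof.lean (cdisprove c1) honoured: (F1) h4 is now USED (S2c needs `T ≠ 0` near `q`; it is a hypothesis of
the crux, redundant or not); (F4) no `κ`, `Ω_H`, orientation anywhere; (F5) vacuum used on `{g(T,T)<0} ∖ U` via
MzH (S2a) and in the belt via IK (S2c); (F6) docking on the sub-collar `U' ∩ U''`; (F7) h14 (`κ ≠ 0`) NOT used by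
this line at all — the sweep never crosses `𝓗⁺`; Negative lemma `KillingNonvanishingOfIPlusRegular` imported:
no stub is an instance.  Barrier `IonescuKlainermanNonExtension` (IK 2013 Thm 1.3, local hair behind a
non-convex `T`-invariant timelike hypersurface of Kerr): it is exactly WHY G1 asks strict `T`-null-convexity at
every belt point — the line continues only across convex levels; the barrier kills G1-free shortcuts, not G1.
-/

set_option linter.dupNamespace false
set_option linter.unusedVariables false
set_option linter.unusedSectionVars false

noncomputable section

namespace Summit.FinalStateConjecture.FinalStateConjecture.Cruxes.NonTrappingHawkingRigidity.ZeroEnergyConvexSweep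

-- the crux BY NAME: the item's decl in the PRIMARY route file (`ZeroEnergyKerrOrBomb`, rank 2); the
-- `AnalyticityInvadesErgoregion` copy (rank 4) is letter-identical and closed at the end (`_of'`).
open Summit.FinalStateConjecture.FinalStateConjecture.Theses.ZeroEnergyKerrOrBomb (NonTrappingHawkingRigidity)
open Literature.Geometry.Lorentzian
open scoped Manifold ContDiff Topology Nat
open Set Filter

/-! ## §1 Vocabulary (over existing declarations; the rev-8 predicates of the live line VERBATIM where shared,
so that the four landed stubs read back definitionally, plus ONE new predicate `IsTNullConvexAt`) -/

section Vocabulary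

variable (𝓑 : StationaryAFBlackHole.{0}) [𝓑.metric.HasLeviCivita]

/-- `L` is a LOCAL `T`-COMMUTING KILLING FIELD on the set `W` (smooth section on `W`, Killing equation on `W`,
`[T, L] = 0` on `W`) — verbatim the live line's predicate. [cite: ONeill1983, Ch. 9, Def. 9.22] -/
def IsLocalKilling (W : Set 𝓑.carrier) (L : Π x : 𝓑.carrier, TangentSpace (𝓡 4) x) : Prop :=
  ContMDiffOn (𝓡 4) ((𝓡 4).prod 𝓘(ℝ, E4)) ((⊤ : ℕ∞) : WithTop ℕ∞)
      (fun x ↦ (Bundle.TotalSpace.mk' E4 x (L x) : TangentBundle (𝓡 4) 𝓑.carrier)) W ∧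
    (∀ x ∈ W, ∀ v w : TangentSpace (𝓡 4) x,
      𝓑.metric.val x (𝓑.metric.leviCivita L x v) w + 𝓑.metric.val x v (𝓑.metric.leviCivita L x w) = 0) ∧
    ∀ x ∈ W, VectorField.mlieBracket (𝓡 4) 𝓑.killing L x = 0

/-- The KILLING–TIMELIKE COLLAR hypotheses on `(U, K)` — verbatim the crux (h6–h14).
[cite: AlexakisIonescuKlainerman2010, Thm. 1.1] -/
def IsKillingTimelikeCollar (U : Set 𝓑.carrier) (K : Π x : 𝓑.carrier, TangentSpace (𝓡 4) x) : Prop :=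
  IsOpen U ∧ 𝓑.horizon ⊆ U ∧ IsConnected 𝓑.horizon ∧ IsLocalKilling 𝓑 U K ∧
    (∀ p ∈ 𝓑.horizon, K p ≠ 0) ∧
    (∀ γ : ℝ → 𝓑.carrier, IsMIntegralCurve γ K → γ 0 ∈ 𝓑.horizon → ∀ t, γ t ∈ 𝓑.horizon) ∧
    ∀ x ∈ U ∩ 𝓑.doc, 𝓑.metric.val x (K x) (K x) < 0

/-- The closed-ergoregion BELT off the collar is compact modulo the stationary flow — verbatim h15.
[cite: ChruscielCosta2008, §4] -/
def BeltCompactModFlow (U : Set 𝓑.carrier) : Prop :=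
  ∃ S₀ : Set 𝓑.carrier, IsCompact S₀ ∧ S₀ ⊆ 𝓑.doc ∧ ∀ y ∈ 𝓑.doc,
    0 ≤ 𝓑.metric.val y (𝓑.killing y) (𝓑.killing y) → y ∉ U → y ∈ stationaryOrbit 𝓑.killing S₀

/-- NO ZERO-ENERGY NULL GEODESIC TRAPPED MODULO THE FLOW — verbatim h16. [cite: IonescuKlainerman2015, §4] -/
def NoTrappedGeodesicModFlow : Prop :=
  ∀ S : Set 𝓑.carrier, IsCompact S → S ⊆ 𝓑.doc → ∀ (γ : ℝ → 𝓑.carrier) (s : Set ℝ),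
    IsMaximalGeodesicOn 𝓑.metric.toPseudoRiemannianMetric.leviCivita γ s → s.Nonempty →
      (∀ t ∈ s, 𝓑.metric.val (γ t) (velocity (𝓡 4) γ t) (velocity (𝓡 4) γ t) = 0 ∧
        velocity (𝓡 4) γ t ≠ 0 ∧ 𝓑.metric.val (γ t) (velocity (𝓡 4) γ t) (𝓑.killing (γ t)) = 0) →
      ∃ t ∈ s, γ t ∉ stationaryOrbit 𝓑.killing S

/-- The strict sub-level set `{x ∈ doc | f x < c}`. [folklore] -/
def subLevel (f : 𝓑.carrier → ℝ) (c : ℝ) : Set 𝓑.carrier :=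
  {x | x ∈ 𝓑.doc ∧ f x < c}

/-- A `T`-invariant TIMELIKE SWEEP of the d.o.c. off the sub-collar `U'` — verbatim the live line's
`IsTimelikeSweep` (smooth on doc, `df(T) = 0`, `{f < c₀} ∩ doc = U' ∩ doc`, spacelike gradient off the
sub-collar, slabs compact mod `T`).  On Kerr `f = r`. [cite: AlexakisIonescuKlainerman2010, §1 (the `r`-foliation)] -/
def IsTimelikeSweep (U' : Set 𝓑.carrier) (f : 𝓑.carrier → ℝ) (c₀ : ℝ) : Prop :=
  ContMDiffOn (𝓡 4) 𝓘(ℝ, ℝ) ((⊤ : ℕ∞) : WithTop ℕ∞) f 𝓑.doc ∧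
    (∀ x ∈ 𝓑.doc, mfderiv (𝓡 4) 𝓘(ℝ, ℝ) f x (𝓑.killing x) = 0) ∧
    subLevel 𝓑 f c₀ = U' ∩ 𝓑.doc ∧
    (∀ x ∈ 𝓑.doc, c₀ ≤ f x → ∃ w : TangentSpace (𝓡 4) x, 0 < 𝓑.metric.val x w w ∧
      ∀ u : TangentSpace (𝓡 4) x, mfderiv (𝓡 4) 𝓘(ℝ, ℝ) f x u = 𝓑.metric.val x w u) ∧
    ∀ c : ℝ, ∃ S : Set 𝓑.carrier, IsCompact S ∧ S ⊆ 𝓑.doc ∧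
      {x | x ∈ 𝓑.doc ∧ c₀ ≤ f x ∧ f x ≤ c} ⊆ stationaryOrbit 𝓑.killing S

/-- `D` supports `q` through a NON-NULL level of `f` — verbatim the live line's `NonNullSupportAt`.
[cite: IonescuKlainerman2012, Def. 1.1 (defining function)] -/
def NonNullSupportAt (D : Set 𝓑.carrier) (q : 𝓑.carrier) (f : 𝓑.carrier → ℝ) : Prop :=
  ∃ N : Set 𝓑.carrier, IsOpen N ∧ q ∈ N ∧
    ContMDiffOn (𝓡 4) 𝓘(ℝ, ℝ) ((⊤ : ℕ∞) : WithTop ℕ∞) f N ∧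
    (∃ nq : TangentSpace (𝓡 4) q, 𝓑.metric.val q nq nq ≠ 0 ∧
      ∀ w : TangentSpace (𝓡 4) q, mfderiv (𝓡 4) 𝓘(ℝ, ℝ) f q w = 𝓑.metric.val q nq w) ∧
    ∀ x ∈ N ∩ 𝓑.doc, x ∈ D ↔ f x < f q

/-- A ONE-STEP CONTINUATION of `(D, L)` AT `q` — verbatim the live line's `PointContinuationAt`.
[cite: IonescuKlainerman2012, Thm. 1.2 (shape of the conclusion)] -/
def PointContinuationAt (D : Set 𝓑.carrier) (L : Π x : 𝓑.carrier, TangentSpace (𝓡 4) x)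
    (q : 𝓑.carrier) : Prop :=
  ∃ (W : Set 𝓑.carrier) (L' : Π x : 𝓑.carrier, TangentSpace (𝓡 4) x),
    IsOpen W ∧ q ∈ W ∧ W ⊆ 𝓑.doc ∧ IsLocalKilling 𝓑 W L' ∧ ∀ x ∈ W ∩ D, L' x = L x

/-- **NEW — STRICT `T`-NULL-CONVEXITY of the level of `f` at `q` towards `{f < f q}`**
(`IsTNullConvexAt 𝓑 f q`): for every NON-ZERO tangent vector `X` at `q` which is NULL, ORTHOGONAL TO `T` and
TANGENT to the level (`df_q(X) = 0`), the covariant Hessian is negative, `Hess f (X, X)(q) < 0` — verbatim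
Ionescu–Klainerman's Definition 2.2 (defining function `h = f − f q`, `O = {h < 0}`) with the tree's
`PseudoRiemannianMetric.hessian`.  VOID where `T` is timelike (no non-zero null `X ⊥ T`); at an ergosurface point
(`T` null) the only direction is `X ∥ T` and the condition reads `Hess f (T, T) = ½ g(∇ g(T,T), ∇f) < 0`, i.e.
`g(T,T)` DEcreases across the level outward; at interior belt points (`T` spacelike, `∇f` spacelike, `∇f ⊥ T`)
exactly TWO null lines `X±` of the Lorentzian 2-plane `T⊥ ∩ ∇f⊥` are constrained.  Kerr, `f = r`, every point
beyond `r₊`: `Kerr.hessAt_radius_neg_of_ksEnergy_eq_zero` (kernel-checked).  Qualitative ⇔ IK's quantitative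
multiplier form (Lemma 2.17) at a point: on the 2-plane take `μ = −Hess f(X₊, X₋)`, then add
`A((df X)² + g(T,X)²)` by the Finsler lemma (S2c's first brick).
[cite: IonescuKlainerman2015, Def. 2.2 and Lemma 2.17] [cite: IonescuKlainerman2012, Def. 1.1] -/
def IsTNullConvexAt (f : 𝓑.carrier → ℝ) (q : 𝓑.carrier) : Prop :=
  ∀ X : TangentSpace (𝓡 4) q, X ≠ 0 → 𝓑.metric.val q X X = 0 →
    𝓑.metric.val q X (𝓑.killing q) = 0 → mfderiv (𝓡 4) 𝓘(ℝ, ℝ) f q X = 0 →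
    𝓑.metric.toPseudoRiemannianMetric.hessian f q X X < 0

end Vocabulary

/-! ### The radial function of S1b (landed; predicate verbatim) -/

section Bet

/-- A `T`-invariant radial function of the d.o.c. adapted to the horizon, (R1)–(R6) — verbatim the live line's
`IsInvariantRadialFunction` (the landed S1b / S1b₇ produce one from the Chruściel–Costa product structure; on Kerr
`ρ = r − r₊`). [cite: ChruscielCosta2008, Thm. 4.5] -/
def IsInvariantRadialFunction (𝓑 : StationaryAFBlackHole.{0}) (ρ : 𝓑.carrier → ℝ) : Prop :=
  ContMDiffOn (𝓡 4) 𝓘(ℝ, ℝ) ((⊤ : ℕ∞) : WithTop ℕ∞) ρ 𝓑.doc ∧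
  (∀ x ∈ 𝓑.doc, mfderiv (𝓡 4) 𝓘(ℝ, ℝ) ρ x (𝓑.killing x) = 0) ∧
  (∀ x ∈ 𝓑.doc, mfderiv (𝓡 4) 𝓘(ℝ, ℝ) ρ x ≠ 0) ∧
  (∀ c : ℝ, 0 < c → ∃ U' : Set 𝓑.carrier, IsOpen U' ∧ 𝓑.horizon ⊆ U' ∧
    U' ∩ 𝓑.doc = {x | x ∈ 𝓑.doc ∧ ρ x < c}) ∧
  (∀ U₁ : Set 𝓑.carrier, IsOpen U₁ → 𝓑.horizon ⊆ U₁ →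
    (∀ γ : ℝ → 𝓑.carrier, IsMIntegralCurve γ 𝓑.killing → γ 0 ∈ U₁ ∩ 𝓑.doc →
      ∀ t, γ t ∈ U₁ ∩ 𝓑.doc) →
    ∃ c : ℝ, 0 < c ∧ {x | x ∈ 𝓑.doc ∧ ρ x < c} ⊆ U₁) ∧
  (∀ c₀ c : ℝ, 0 < c₀ → ∃ S : Set 𝓑.carrier, IsCompact S ∧ S ⊆ 𝓑.doc ∧
    {x | x ∈ 𝓑.doc ∧ c₀ ≤ ρ x ∧ ρ x ≤ c} ⊆ stationaryOrbit 𝓑.killing S)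

end Bet

/-! ## §2 Small facts (sorry-free; verbatim from the live line §2, lead a1) -/

section Facts

variable (𝓑 : StationaryAFBlackHole.{0}) [𝓑.metric.HasLeviCivita]

/-- The d.o.c. is open (O'Neill Lemma 14.3, proved in the tree for boundaryless carriers).
[cite: ONeillSemiRiemannian1983, Ch. 14, Lemma 14.3] -/
theorem isOpen_doc : IsOpen 𝓑.doc :=
  𝓑.isOpen_doc
    (LorentzianMetric.isOpen_chronologicalFuture_holds_of_boundaryless (g := 𝓑.metric) (τ := 𝓑.timeOrientation))
    (LorentzianMetric.isOpen_chronologicalPast_holds_of_boundaryless (g := 𝓑.metric) (τ := 𝓑.timeOrientation))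

variable {𝓑}

/-- Unfolding lemma for `subLevel`. [folklore] -/
@[simp] theorem mem_subLevel {f : 𝓑.carrier → ℝ} {c : ℝ} {x : 𝓑.carrier} :
    x ∈ subLevel 𝓑 f c ↔ x ∈ 𝓑.doc ∧ f x < c := Iff.rfl

/-- Sub-level sets are monotone in the level. [folklore] -/
theorem subLevel_mono (f : 𝓑.carrier → ℝ) {c c' : ℝ} (h : c ≤ c') : subLevel 𝓑 f c ⊆ subLevel 𝓑 f c' :=
  fun _ hx ↦ ⟨hx.1, lt_of_lt_of_le hx.2 h⟩

/-- Sub-level sets lie in the d.o.c. [folklore] -/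
theorem subLevel_subset_doc (f : 𝓑.carrier → ℝ) (c : ℝ) : subLevel 𝓑 f c ⊆ 𝓑.doc := fun _ hx ↦ hx.1

/-- A sub-level set of a function continuous on the (open) d.o.c. is open. [folklore] -/
theorem isOpen_subLevel {f : 𝓑.carrier → ℝ} (hf : ContinuousOn f 𝓑.doc) (c : ℝ) :
    IsOpen (subLevel 𝓑 f c) :=
  hf.isOpen_inter_preimage (isOpen_doc 𝓑) isOpen_Iio

/-- Restriction of a local `T`-commuting Killing field to a subset. [folklore] -/
theorem IsLocalKilling.mono {W W' : Set 𝓑.carrier} {L : Π x : 𝓑.carrier, TangentSpace (𝓡 4) x}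
    (h : IsLocalKilling 𝓑 W L) (hW : W' ⊆ W) : IsLocalKilling 𝓑 W' L :=
  ⟨h.1.mono hW, fun x hx ↦ h.2.1 x (hW hx), fun x hx ↦ h.2.2 x (hW hx)⟩

/-- **Gluing / locality of `IsLocalKilling`** (verbatim the live line's lemma; uses
`PseudoRiemannianMetric.leviCivita_congr_nhds`, `LeviCivitaLocality.lean` p136112). [folklore] -/
theorem IsLocalKilling.of_locally {W : Set 𝓑.carrier} {L : Π x : 𝓑.carrier, TangentSpace (𝓡 4) x}
    (h : ∀ x ∈ W, ∃ (O : Set 𝓑.carrier) (L₀ : Π x : 𝓑.carrier, TangentSpace (𝓡 4) x),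
      IsOpen O ∧ x ∈ O ∧ IsLocalKilling 𝓑 O L₀ ∧ ∀ y ∈ O, L y = L₀ y) :
    IsLocalKilling 𝓑 W L := by
  refine ⟨fun x hx ↦ ?_, fun x hx v w ↦ ?_, fun x hx ↦ ?_⟩
  · obtain ⟨O, L₀, hO, hxO, hL₀, hagree⟩ := h x hx
    have hOn : O ∈ 𝓝 x := hO.mem_nhds hxO
    have hev : (fun y ↦ (Bundle.TotalSpace.mk' E4 y (L y) : TangentBundle (𝓡 4) 𝓑.carrier)) =ᶠ[𝓝 x]
        (fun y ↦ (Bundle.TotalSpace.mk' E4 y (L₀ y) : TangentBundle (𝓡 4) 𝓑.carrier)) := by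
      filter_upwards [hOn] with y hy
      rw [hagree y hy]
    have h0 : ContMDiffAt (𝓡 4) ((𝓡 4).prod 𝓘(ℝ, E4)) ((⊤ : ℕ∞) : WithTop ℕ∞)
        (fun y ↦ (Bundle.TotalSpace.mk' E4 y (L₀ y) : TangentBundle (𝓡 4) 𝓑.carrier)) x :=
      (hL₀.1 x hxO).contMDiffAt hOn
    exact (h0.congr_of_eventuallyEq hev).contMDiffWithinAt
  · obtain ⟨O, L₀, hO, hxO, hL₀, hagree⟩ := h x hx
    have hev : L =ᶠ[𝓝 x] L₀ := by
      filter_upwards [hO.mem_nhds hxO] with y hy using hagree y hy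
    have hlc : 𝓑.metric.leviCivita L x = 𝓑.metric.leviCivita L₀ x :=
      PseudoRiemannianMetric.leviCivita_congr_nhds 𝓑.metric.toPseudoRiemannianMetric hev
    rw [hlc]
    exact hL₀.2.1 x hxO v w
  · obtain ⟨O, L₀, hO, hxO, hL₀, hagree⟩ := h x hx
    have hev : L =ᶠ[𝓝 x] L₀ := by
      filter_upwards [hO.mem_nhds hxO] with y hy using hagree y hy
    have : VectorField.mlieBracket (𝓡 4) 𝓑.killing L x = VectorField.mlieBracket (𝓡 4) 𝓑.killing L₀ x :=
      (EventuallyEq.rfl (f := 𝓑.killing)).mlieBracket_vectorField_eq hev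
    rw [this]
    exact hL₀.2.2 x hxO

end Facts

/-! ## §3 Registered stubs (`sorry` ONLY here; shape `Holds.stub_<name>` + by-name handle).  The statements are
written over LITERATURE VOCABULARY ONLY (§1 predicates inlined) so that a stub landed under `Theorems/` with
Literature imports alone matches the registered signature letter for letter; `stub_<name>_iff` reads each back. -/

namespace Holds

/-- **Stub G1 · convexRadialFunction — THE BET (the AIK programme's "ingredient 2": a GLOBAL `T`-invariant
radial function whose levels are strictly `T`-null-convex across the belt); research-sized; TRUE with margin on
every sub-extremal Kerr exterior (kernel: `Kerr.hessAt_radius_neg_of_ksEnergy_eq_zero`, `ρ = r − r₊`).**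
Under the crux's binders h1–h16 (verbatim) and given ANY structural radial function `ρ₀` of the d.o.c.
((R1) smooth on doc, (R2) `dρ₀(T) = 0`, (R3) `dρ₀ ≠ 0`, (R4) horizon-adjacent sub-levels, (R5) thin,
(R6) slabs compact mod `T` — the landed S1b/S1b₇ supply one), THERE IS a radial function `ρ` with (R1)–(R6) AND
(C1) SPACELIKE GRADIENT on the closed ergoregion (`dρ = g(w,·)`, `g(w,w) > 0` wherever `g(T,T) ≥ 0`; automatic
where `T` is timelike, O'Neill 5.26) AND (C2) STRICT `T`-NULL-CONVEXITY of its level towards `{ρ < ρ q}` at every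
BELT POINT `q` off the collar (`q ∈ doc`, `g(T,T)(q) ≥ 0`, `q ∉ U`): `Hess ρ (X, X)(q) < 0` for every `X ≠ 0`
null, `g(X, T) = 0`, `dρ(X) = 0`.
PROOF INTENDED (candidates, in order).  (i) THE CANONICAL FUNCTION: the Ionescu–Klainerman radial function
`y := Re (1 − σ_T)⁻¹` of the Ernst potential `σ_T = −g(T,T) + iω_T` (the twist 1-form `⋆(T♭ ∧ dT♭)` is closed in
vacuum — h1 — and exact on the simply connected d.o.c. — h5, its one use); on Kerr `y = r/(2M)` up to
normalisation and (C2) is `R′(r) = −2(r − M)(L² + Q) < 0` (Carter); AIK CMP 299 (2010) Lemma 4.3 derives (C2) for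
`y` from smallness of the Mars–Simon tensor; the bet is that h16 (no zero-energy ray trapped mod `T`) forces it in
general — h16 is NECESSARY (a `T`-null-convex exhaustion of the belt forbids trapped zero-energy rays) and the
belt region where (C2) has content is compact mod `T` (h15); glue `y` to `ρ₀` below a sub-collar level and above
the belt (both (R4)–(R6) regions; a monotone reparametrisation in the slab keeps `dρ ≠ 0`).  (ii) DYNAMICAL:
build the exhaustion from the non-trapped zero-energy flow on the compact-mod-`T` belt quotient (exit-time /
Lyapunov smoothing, the Lorentzian-null analogue of Betelú–Gulliver–Littman's convex function on non-trapping
surfaces — in the belt quotient a level is 2-dimensional and timelike and only its TWO null directions are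
constrained, the same count as curve convexity on a surface).  (iii) PERTURBATIVE SUB-CASES already theorems in
print: Mars–Simon-small (AIK 2010) and `‖g(T,T)‖_{L∞(S₀)}` small (AIK Duke 2014 Prop. 1.3: belt ⊆ collar, (C2) void).
WHY IT MIGHT FAIL.  Non-trapping does not imply a convex exhaustion in general optics (TRIAGE 10690 r1-2 (b); in
Riemannian dimension ≥ 3 the "foliation condition" is an independent hypothesis, Paternain–Salo–Uhlmann–Zhou 2019);
a smooth stationary belt (necessarily non-vacuum or non-Kerr) with Γ₀ = ∅ mod `T` whose every `T`-invariant radial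
function has a non-convex zero-energy tangency would kill (ii) and, if vacuum, the line — not the crux.  The
`T ↦ T + cZ` caveat of IK 2015 §4 does not bite: the crux FIXES `T` (the stationary field of the telescope) and
(C2) is about ITS zero-energy directions only.
[cite: AlexakisIonescuKlainerman2010b, Lemma 4.3] [cite: IonescuKlainerman2015, §3.7 and §4]
[cite: AlexakisIonescuKlainerman2014, Prop. 1.3] [cite: IonescuKlainerman2009, §3.1 (HoCond2)]
[cite: BeteluGulliverLittman2002, Thm. 1] -/
theorem stub_convexRadialFunction :
    ∀ (𝓑 : StationaryAFBlackHole.{0}) [𝓑.metric.HasLeviCivita],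
      𝓑.metric.toPseudoRiemannianMetric.IsRicciFlat → 𝓑.IsIPlusRegular →
      (∀ p : 𝓑.carrier, p ∈ 𝓑.metric.chronologicalFuture 𝓑.timeOrientation 𝓑.Mext) →
      (∀ p ∈ 𝓑.doc, 𝓑.killing p ≠ 0) → SimplyConnectedSpace 𝓑.doc →
      ∀ (U : Set 𝓑.carrier) (K : Π x : 𝓑.carrier, TangentSpace (𝓡 4) x), IsOpen U → 𝓑.horizon ⊆ U →
      IsConnected 𝓑.horizon →
      𝓑.metric.toPseudoRiemannianMetric.IsKillingFieldOn K U →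
      (∀ x ∈ U, VectorField.mlieBracket (𝓡 4) 𝓑.killing K x = 0) → (∀ p ∈ 𝓑.horizon, K p ≠ 0) →
      (∀ γ : ℝ → 𝓑.carrier, IsMIntegralCurve γ K → γ 0 ∈ 𝓑.horizon → ∀ t, γ t ∈ 𝓑.horizon) →
      (∀ x ∈ U ∩ 𝓑.doc, 𝓑.metric.val x (K x) (K x) < 0) →
      (∃ S₀ : Set 𝓑.carrier, IsCompact S₀ ∧ S₀ ⊆ 𝓑.doc ∧ ∀ y ∈ 𝓑.doc,
        0 ≤ 𝓑.metric.val y (𝓑.killing y) (𝓑.killing y) → y ∉ U → y ∈ stationaryOrbit 𝓑.killing S₀) →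
      (∀ S : Set 𝓑.carrier, IsCompact S → S ⊆ 𝓑.doc → ∀ (γ : ℝ → 𝓑.carrier) (s : Set ℝ),
        IsMaximalGeodesicOn 𝓑.metric.toPseudoRiemannianMetric.leviCivita γ s → s.Nonempty →
        (∀ t ∈ s, 𝓑.metric.val (γ t) (velocity (𝓡 4) γ t) (velocity (𝓡 4) γ t) = 0 ∧
          velocity (𝓡 4) γ t ≠ 0 ∧ 𝓑.metric.val (γ t) (velocity (𝓡 4) γ t) (𝓑.killing (γ t)) = 0) →
        ∃ t ∈ s, γ t ∉ stationaryOrbit 𝓑.killing S) →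
      ∀ ρ₀ : 𝓑.carrier → ℝ,
      (ContMDiffOn (𝓡 4) 𝓘(ℝ, ℝ) ((⊤ : ℕ∞) : WithTop ℕ∞) ρ₀ 𝓑.doc ∧
        (∀ x ∈ 𝓑.doc, mfderiv (𝓡 4) 𝓘(ℝ, ℝ) ρ₀ x (𝓑.killing x) = 0) ∧
        (∀ x ∈ 𝓑.doc, mfderiv (𝓡 4) 𝓘(ℝ, ℝ) ρ₀ x ≠ 0) ∧
        (∀ c : ℝ, 0 < c → ∃ U' : Set 𝓑.carrier, IsOpen U' ∧ 𝓑.horizon ⊆ U' ∧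
          U' ∩ 𝓑.doc = {x | x ∈ 𝓑.doc ∧ ρ₀ x < c}) ∧
        (∀ U₁ : Set 𝓑.carrier, IsOpen U₁ → 𝓑.horizon ⊆ U₁ →
          (∀ γ : ℝ → 𝓑.carrier, IsMIntegralCurve γ 𝓑.killing → γ 0 ∈ U₁ ∩ 𝓑.doc →
            ∀ t, γ t ∈ U₁ ∩ 𝓑.doc) →
          ∃ c : ℝ, 0 < c ∧ {x | x ∈ 𝓑.doc ∧ ρ₀ x < c} ⊆ U₁) ∧
        (∀ c₀ c : ℝ, 0 < c₀ → ∃ S : Set 𝓑.carrier, IsCompact S ∧ S ⊆ 𝓑.doc ∧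
          {x | x ∈ 𝓑.doc ∧ c₀ ≤ ρ₀ x ∧ ρ₀ x ≤ c} ⊆ stationaryOrbit 𝓑.killing S)) →
      ∃ ρ : 𝓑.carrier → ℝ,
      (ContMDiffOn (𝓡 4) 𝓘(ℝ, ℝ) ((⊤ : ℕ∞) : WithTop ℕ∞) ρ 𝓑.doc ∧
        (∀ x ∈ 𝓑.doc, mfderiv (𝓡 4) 𝓘(ℝ, ℝ) ρ x (𝓑.killing x) = 0) ∧
        (∀ x ∈ 𝓑.doc, mfderiv (𝓡 4) 𝓘(ℝ, ℝ) ρ x ≠ 0) ∧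
        (∀ c : ℝ, 0 < c → ∃ U' : Set 𝓑.carrier, IsOpen U' ∧ 𝓑.horizon ⊆ U' ∧
          U' ∩ 𝓑.doc = {x | x ∈ 𝓑.doc ∧ ρ x < c}) ∧
        (∀ U₁ : Set 𝓑.carrier, IsOpen U₁ → 𝓑.horizon ⊆ U₁ →
          (∀ γ : ℝ → 𝓑.carrier, IsMIntegralCurve γ 𝓑.killing → γ 0 ∈ U₁ ∩ 𝓑.doc →
            ∀ t, γ t ∈ U₁ ∩ 𝓑.doc) →
          ∃ c : ℝ, 0 < c ∧ {x | x ∈ 𝓑.doc ∧ ρ x < c} ⊆ U₁) ∧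
        (∀ c₀ c : ℝ, 0 < c₀ → ∃ S : Set 𝓑.carrier, IsCompact S ∧ S ⊆ 𝓑.doc ∧
          {x | x ∈ 𝓑.doc ∧ c₀ ≤ ρ x ∧ ρ x ≤ c} ⊆ stationaryOrbit 𝓑.killing S)) ∧
      (∀ q ∈ 𝓑.doc, 0 ≤ 𝓑.metric.val q (𝓑.killing q) (𝓑.killing q) →
        ∃ w : TangentSpace (𝓡 4) q, 0 < 𝓑.metric.val q w w ∧
          ∀ u : TangentSpace (𝓡 4) q, mfderiv (𝓡 4) 𝓘(ℝ, ℝ) ρ q u = 𝓑.metric.val q w u) ∧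
      ∀ q ∈ 𝓑.doc, 0 ≤ 𝓑.metric.val q (𝓑.killing q) (𝓑.killing q) → q ∉ U →
        ∀ X : TangentSpace (𝓡 4) q, X ≠ 0 → 𝓑.metric.val q X X = 0 →
          𝓑.metric.val q X (𝓑.killing q) = 0 → mfderiv (𝓡 4) 𝓘(ℝ, ℝ) ρ q X = 0 →
          𝓑.metric.toPseudoRiemannianMetric.hessian ρ q X X < 0 := by
  sorry

/-- **Stub S2c · conditionalCarlemanContinuation — THE IN-PRINT LEVER: Ionescu–Klainerman's `T`-CONDITIONAL
local extension of a `T`-commuting Killing field across a strictly `T`-null-convex level, AT ONE SUPPORTED POINT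
of the d.o.c.; size L–XL of bookkeeping, provable now modulo the named fact it takes (VENDORED:
`IonescuKlainermanConditionalLocalExtension`, IK 2015 Thm 2.4 / Def. 2.2 / Lemma 2.17 in chart form, `d = 4`,
constant conditioning field).**  In a Ricci-flat `𝓑` with `T ≠ 0` on the d.o.c., let `L` be a local `T`-commuting
Killing field on an open `D ⊆ doc`, `q ∈ doc`, `D` the strict sub-level side near `q` of a function `f` smooth near
`q` with NON-NULL gradient at `q` (`NonNullSupportAt`), `f` `T`-INVARIANT near `q` (`df(T) = 0` on an open
`N' ∋ q`), and the level `{f = f q}` STRICTLY `T`-NULL-CONVEX at `q` towards `{f < f q}` (`IsTNullConvexAt`).  Then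
`(D, L)` has a one-step continuation at `q`: an open `W ∋ q` in the d.o.c. and a local `T`-commuting Killing
`L'` on `W` with `L' = L` on `W ∩ D`.
PROOF INTENDED (the `GapExhaustion` bridging pattern, general `𝓑`).  (1) Flow-box chart `ψ` of the maximal atlas
at `q` straightening the non-vanishing `T` to a constant vector `τ` (`Literature/Geometry/Manifold/FlowBox.lean`);
in it `∂_τ G = 0` (Killing, `hasDerivAt_val_coordVector_of_killing_at` pattern), `∂_τ f̃ = 0`, `∂_τ Z = 0`
(`[T, L] = 0`, `CommutingFlowLocal.lean`).  (2) Lorentz normalisation at `ψ q` (`stub_lorentzNormalisation`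
p133042 pattern) and affine rescaling to the unit ball with `Σ‖DʲG‖ + Σ‖Dʲf̃‖ ≤ A` (smooth on a compact ball),
`A₁⁻¹ ≤ ‖τ‖ ≤ A₁` after enlarging `A₁`.  (3) Quantitative convexity (quant6-T) at `ψ q` from `IsTNullConvexAt` by
the Finsler lemma (`BartnikGapSettlingGapExhaustionFinslerLemma.lean` pattern; the 2-plane computation in the
docstring of `IsTNullConvexAt`), the coordinate Hessian being the covariant one (`ChartMetricCoord.hessian_eq_hessAt`).
(4) Ricci-flatness and the Killing equation in coordinates (`…IsMetricOnMetricInCoords`, `…KillingCoordBridge`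
patterns), data on `ball ∩ {f̃ < 0}` = `ψ(D ∩ N)` by `NonNullSupportAt`.  (5) Apply the fact; push `Z'` forward
(`…ContMDiffOnPushforwardField` pattern): smooth, Killing, `∂_τ Z' = 0 ⇒ [T, L'] = 0`; `W := ψ⁻¹(ball δ₁) ∩ N ∩ doc`.
WHY IT MIGHT FAIL.  Only bookkeeping (the flow-box chart must be in the maximal `C^∞` atlas; sixth derivatives of
the pulled-back metric on a compact ball).  The mathematics is the cited theorem.
[cite: IonescuKlainerman2015, Thm 2.4, Def. 2.2, Lemma 2.17] [cite: IonescuKlainerman2012, Thm. 1.2 and remark]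
[cite: AlexakisIonescuKlainerman2010b, §5 (Lemma 5.? conditional Carleman), App. A] -/
theorem stub_conditionalCarlemanContinuation :
    IonescuKlainermanConditionalLocalExtension →
    ∀ (𝓑 : StationaryAFBlackHole.{0}) [𝓑.metric.HasLeviCivita],
      𝓑.metric.toPseudoRiemannianMetric.IsRicciFlat → (∀ p ∈ 𝓑.doc, 𝓑.killing p ≠ 0) →
      ∀ (D : Set 𝓑.carrier) (L : Π x : 𝓑.carrier, TangentSpace (𝓡 4) x), IsOpen D → D ⊆ 𝓑.doc →
      𝓑.metric.toPseudoRiemannianMetric.IsKillingFieldOn L D →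
      (∀ x ∈ D, VectorField.mlieBracket (𝓡 4) 𝓑.killing L x = 0) →
      ∀ q ∈ 𝓑.doc, ∀ f : 𝓑.carrier → ℝ,
      (∃ N : Set 𝓑.carrier, IsOpen N ∧ q ∈ N ∧
        ContMDiffOn (𝓡 4) 𝓘(ℝ, ℝ) ((⊤ : ℕ∞) : WithTop ℕ∞) f N ∧
        (∃ nq : TangentSpace (𝓡 4) q, 𝓑.metric.val q nq nq ≠ 0 ∧
          ∀ w : TangentSpace (𝓡 4) q, mfderiv (𝓡 4) 𝓘(ℝ, ℝ) f q w = 𝓑.metric.val q nq w) ∧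
        ∀ x ∈ N ∩ 𝓑.doc, x ∈ D ↔ f x < f q) →
      (∃ N' : Set 𝓑.carrier, IsOpen N' ∧ q ∈ N' ∧
        ∀ x ∈ N', mfderiv (𝓡 4) 𝓘(ℝ, ℝ) f x (𝓑.killing x) = 0) →
      (∀ X : TangentSpace (𝓡 4) q, X ≠ 0 → 𝓑.metric.val q X X = 0 →
        𝓑.metric.val q X (𝓑.killing q) = 0 → mfderiv (𝓡 4) 𝓘(ℝ, ℝ) f q X = 0 →
        𝓑.metric.toPseudoRiemannianMetric.hessian f q X X < 0) →
      ∃ (W : Set 𝓑.carrier) (L' : Π x : 𝓑.carrier, TangentSpace (𝓡 4) x),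
        IsOpen W ∧ q ∈ W ∧ W ⊆ 𝓑.doc ∧
        (ContMDiffOn (𝓡 4) ((𝓡 4).prod 𝓘(ℝ, E4)) ((⊤ : ℕ∞) : WithTop ℕ∞)
            (fun x ↦ (Bundle.TotalSpace.mk' E4 x (L' x) : TangentBundle (𝓡 4) 𝓑.carrier)) W ∧
          (∀ x ∈ W, ∀ v w : TangentSpace (𝓡 4) x,
            𝓑.metric.val x (𝓑.metric.leviCivita L' x v) w + 𝓑.metric.val x v (𝓑.metric.leviCivita L' x w) = 0) ∧
          ∀ x ∈ W, VectorField.mlieBracket (𝓡 4) 𝓑.killing L' x = 0) ∧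
        ∀ x ∈ W ∩ D, L' x = L x := by
  sorry

/-- **Stub D′ · carlemanLineDebts — the FOUR named facts of the tree this line consumes, by name:** the
Chruściel–Costa equivariant time function (`DocStructureTimeFunction.lean`; feeds the LANDED S1a), Müller zum
Hagen's analyticity where a Killing field is timelike (`MullerZumHagenAnalyticity.lean`; feeds the LANDED S2a at
`T`-timelike and collar points — Disproof (F5): vacuum is consumed on `{g(T,T) < 0} ∖ U`), the Chruściel–Costa
product structure (`DocProductStructure.lean`, p145855; feeds the LANDED S1b₇), and Ionescu–Klainerman's
`T`-conditional local extension theorem in chart form (`KillingFieldLocalExtension.lean`; feeds S2c).  Each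
conjunct closes by its `_holds` the day a literature prover discharges it (sizes L, XL, XL, XL: the last one is the
Carleman machinery of IK 2013 / AIK 2010).  Nomizu's theorem, needed by S2a, is already DISCHARGED
(`PseudoRiemannianMetric.Nomizu1960_killing_extension_holds`) and is not a debt.
[cite: ChruscielCosta2008, Thm. 4.5 and Prop. 4.6] [cite: MullerZumHagen1970, Thm.]
[cite: IonescuKlainerman2015, Thm 2.4] -/
theorem stub_carlemanLineDebts :
    chruscielCosta2008_equivariantTimeFunction ∧ mullerZumHagen1970_analytic_of_timelikeKilling ∧
      chruscielCosta2008_docProductStructure ∧ IonescuKlainermanConditionalLocalExtension := by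
  sorry

end Holds

/-! ### By-name handles of the statements (no second copy of the text) -/

/-- Statement of registered stub G1 (`Holds.stub_convexRadialFunction`), by name. -/
def stub_convexRadialFunction : Prop := type_of% Holds.stub_convexRadialFunction

/-- Statement of registered stub S2c (`Holds.stub_conditionalCarlemanContinuation`), by name. -/
def stub_conditionalCarlemanContinuation : Prop := type_of% Holds.stub_conditionalCarlemanContinuation

/-- Statement of registered stub D′ (`Holds.stub_carlemanLineDebts`), by name. -/
def stub_carlemanLineDebts : Prop := type_of% Holds.stub_carlemanLineDebts

/-! ### Read-backs (definitional) and the four LANDED stubs in the vocabulary of §1 -/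

section ReadBack

/-- G1 read back: under the telescope, `∀ ρ₀ radial, ∃ ρ radial ∧ spacelike gradient on the closed ergoregion ∧
`T`-null-convex at belt points off `U`. [folklore] -/
theorem stub_convexRadialFunction_iff :
    stub_convexRadialFunction ↔
      ∀ (𝓑 : StationaryAFBlackHole.{0}) [𝓑.metric.HasLeviCivita]
        (U : Set 𝓑.carrier) (K : Π x : 𝓑.carrier, TangentSpace (𝓡 4) x),
        𝓑.metric.toPseudoRiemannianMetric.IsRicciFlat → 𝓑.IsIPlusRegular →
        (∀ p : 𝓑.carrier, p ∈ 𝓑.metric.chronologicalFuture 𝓑.timeOrientation 𝓑.Mext) →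
        (∀ p ∈ 𝓑.doc, 𝓑.killing p ≠ 0) → SimplyConnectedSpace 𝓑.doc →
        IsKillingTimelikeCollar 𝓑 U K → BeltCompactModFlow 𝓑 U → NoTrappedGeodesicModFlow 𝓑 →
        ∀ ρ₀ : 𝓑.carrier → ℝ, IsInvariantRadialFunction 𝓑 ρ₀ →
        ∃ ρ : 𝓑.carrier → ℝ, IsInvariantRadialFunction 𝓑 ρ ∧
          (∀ q ∈ 𝓑.doc, 0 ≤ 𝓑.metric.val q (𝓑.killing q) (𝓑.killing q) →
            ∃ w : TangentSpace (𝓡 4) q, 0 < 𝓑.metric.val q w w ∧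
              ∀ u : TangentSpace (𝓡 4) q, mfderiv (𝓡 4) 𝓘(ℝ, ℝ) ρ q u = 𝓑.metric.val q w u) ∧
          ∀ q ∈ 𝓑.doc, 0 ≤ 𝓑.metric.val q (𝓑.killing q) (𝓑.killing q) → q ∉ U →
            IsTNullConvexAt 𝓑 ρ q := by
  constructor
  · intro h 𝓑 _ U K h1 h2 h3 h4 h5 ⟨hU, hHU, hconn, ⟨hsm, hkil, hcomm⟩, hne, htan, htl⟩ hbelt hnt ρ₀ hρ₀
    exact h 𝓑 h1 h2 h3 h4 h5 U K hU hHU hconn ⟨hsm, hkil⟩ hcomm hne htan htl hbelt hnt ρ₀ hρ₀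
  · intro h 𝓑 _ h1 h2 h3 h4 h5 U K hU hHU hconn ⟨hsm, hkil⟩ hcomm hne htan htl hbelt hnt ρ₀ hρ₀
    exact h 𝓑 U K h1 h2 h3 h4 h5 ⟨hU, hHU, hconn, ⟨hsm, hkil, hcomm⟩, hne, htan, htl⟩ hbelt hnt ρ₀ hρ₀

/-- S2c read back in the vocabulary of §1 (definitional unfolding). [folklore] -/
theorem stub_conditionalCarlemanContinuation_iff :
    stub_conditionalCarlemanContinuation ↔
      (IonescuKlainermanConditionalLocalExtension →
      ∀ (𝓑 : StationaryAFBlackHole.{0}) [𝓑.metric.HasLeviCivita],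
        𝓑.metric.toPseudoRiemannianMetric.IsRicciFlat → (∀ p ∈ 𝓑.doc, 𝓑.killing p ≠ 0) →
        ∀ (D : Set 𝓑.carrier) (L : Π x : 𝓑.carrier, TangentSpace (𝓡 4) x),
          IsOpen D → D ⊆ 𝓑.doc → IsLocalKilling 𝓑 D L →
          ∀ q ∈ 𝓑.doc, ∀ f : 𝓑.carrier → ℝ, NonNullSupportAt 𝓑 D q f →
            (∃ N' : Set 𝓑.carrier, IsOpen N' ∧ q ∈ N' ∧
              ∀ x ∈ N', mfderiv (𝓡 4) 𝓘(ℝ, ℝ) f x (𝓑.killing x) = 0) →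
            IsTNullConvexAt 𝓑 f q → PointContinuationAt 𝓑 D L q) := by
  constructor
  · intro h hIK 𝓑 _ h1 h4 D L hD hDdoc ⟨hsm, hkil, hcomm⟩ q hq f hsupp hinv hconv
    exact h hIK 𝓑 h1 h4 D L hD hDdoc ⟨hsm, hkil⟩ hcomm q hq f hsupp hinv hconv
  · intro h hIK 𝓑 _ h1 h4 D L hD hDdoc ⟨hsm, hkil⟩ hcomm q hq f hsupp hinv hconv
    exact h hIK 𝓑 h1 h4 D L hD hDdoc ⟨hsm, hkil, hcomm⟩ q hq f hsupp hinv hconv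

/-- **LANDED S1a (p139503) in the vocabulary of §1:** the `T`-invariant Killing sub-collar, from the Chruściel–Costa
time function. [cite: ChruscielCosta2008, Thm. 4.5] -/
theorem landed_invariantKillingSubcollar (hCC : chruscielCosta2008_equivariantTimeFunction)
    {𝓑 : StationaryAFBlackHole.{0}} [𝓑.metric.HasLeviCivita]
    {U : Set 𝓑.carrier} {K : Π x : 𝓑.carrier, TangentSpace (𝓡 4) x}
    (hvac : 𝓑.metric.toPseudoRiemannianMetric.IsRicciFlat) (hreg : 𝓑.IsIPlusRegular)
    (hfp : ∀ p : 𝓑.carrier, p ∈ 𝓑.metric.chronologicalFuture 𝓑.timeOrientation 𝓑.Mext)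
    (hT : ∀ p ∈ 𝓑.doc, 𝓑.killing p ≠ 0) (hsc : SimplyConnectedSpace 𝓑.doc)
    (hcol : IsKillingTimelikeCollar 𝓑 U K) (hbelt : BeltCompactModFlow 𝓑 U)
    (hnt : NoTrappedGeodesicModFlow 𝓑) :
    ∃ (U₁ V U'' : Set 𝓑.carrier) (K₁ : Π x : 𝓑.carrier, TangentSpace (𝓡 4) x),
      IsOpen U₁ ∧ 𝓑.horizon ⊆ U₁ ∧
      (∀ γ : ℝ → 𝓑.carrier, IsMIntegralCurve γ 𝓑.killing → γ 0 ∈ U₁ ∩ 𝓑.doc →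
        ∀ t, γ t ∈ U₁ ∩ 𝓑.doc) ∧
      IsOpen V ∧ 𝓑.horizon ⊆ V ∧ V ⊆ U ∧ V ∩ 𝓑.doc ⊆ U₁ ∧
      IsLocalKilling 𝓑 (U₁ ∩ 𝓑.doc) K₁ ∧
      IsOpen U'' ∧ 𝓑.horizon ⊆ U'' ∧ ∀ x ∈ U'' ∩ 𝓑.doc, K₁ x = K x := by
  obtain ⟨hU, hHU, hconn, ⟨hsm, hkil, hcomm⟩, hne, htan, htl⟩ := hcol
  obtain ⟨U₁, V, U'', K₁, hU₁, hHU₁, hinv, hV, hHV, hVU, hVU₁, ⟨hsm₁, hkil₁, hcomm₁⟩, hU'', hHU'', hdock⟩ :=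
    Summit.FinalStateConjecture.FinalStateConjecture.Theorems.NonTrappingHawkingRigidity.AzimuthalPartialAnalyticity.stub_invariantKillingSubcollar
      hCC 𝓑 hvac hreg hfp hT hsc U K hU hHU hconn hsm hkil hcomm hne htan htl hbelt hnt
  exact ⟨U₁, V, U'', K₁, hU₁, hHU₁, hinv, hV, hHV, hVU, hVU₁, ⟨hsm₁, hkil₁, hcomm₁⟩, hU'', hHU'', hdock⟩

/-- **LANDED S1b₇ (p162333) in the vocabulary of §1:** a structural radial function (R1)–(R6) (+ preconnected
sub-levels, unused here), from the Chruściel–Costa product structure. [cite: ChruscielCosta2008, Thm. 4.5] -/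
theorem landed_invariantRadialFunction (hDPS : chruscielCosta2008_docProductStructure)
    {𝓑 : StationaryAFBlackHole.{0}} [𝓑.metric.HasLeviCivita]
    (hvac : 𝓑.metric.toPseudoRiemannianMetric.IsRicciFlat) (hreg : 𝓑.IsIPlusRegular)
    (hfp : ∀ p : 𝓑.carrier, p ∈ 𝓑.metric.chronologicalFuture 𝓑.timeOrientation 𝓑.Mext)
    (hT : ∀ p ∈ 𝓑.doc, 𝓑.killing p ≠ 0) (hsc : SimplyConnectedSpace 𝓑.doc) (hconn : IsConnected 𝓑.horizon) :
    ∃ ρ₀ : 𝓑.carrier → ℝ, IsInvariantRadialFunction 𝓑 ρ₀ := by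
  obtain ⟨ρ₀, h1, h2, h3, h4, h5, h6, _⟩ :=
    Summit.FinalStateConjecture.FinalStateConjecture.Theorems.NonTrappingHawkingRigidity.AzimuthalPartialAnalyticity.stub_invariantRadialFunctionConnected
      hDPS 𝓑 hvac hreg hfp hT hsc hconn
  exact ⟨ρ₀, h1, h2, h3, h4, h5, h6⟩

/-- **LANDED S2a (p154819) in the vocabulary of §1:** local Nomizu continuation at a chartwise-analytic point
supported through a non-null level. [cite: Nomizu1960, Theorems 1–2] -/
theorem landed_pointContinuationAnalytic (hNo : PseudoRiemannianMetric.Nomizu1960_killing_extension)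
    {𝓑 : StationaryAFBlackHole.{0}} [𝓑.metric.HasLeviCivita]
    {D : Set 𝓑.carrier} {L : Π x : 𝓑.carrier, TangentSpace (𝓡 4) x} (hD : IsOpen D) (hDdoc : D ⊆ 𝓑.doc)
    (hL : IsLocalKilling 𝓑 D L) {q : 𝓑.carrier} (hq : q ∈ 𝓑.doc) {f : 𝓑.carrier → ℝ}
    (hsupp : NonNullSupportAt 𝓑 D q f) (hAn : 𝓑.IsChartwiseAnalyticAt q) :
    PointContinuationAt 𝓑 D L q :=
  Summit.FinalStateConjecture.FinalStateConjecture.Theorems.NonTrappingHawkingRigidity.AzimuthalPartialAnalyticity.stub_pointContinuationAnalytic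
    hNo 𝓑 D L hD hDdoc hL q hq f hsupp hAn

/-- **LANDED S3 (p139035) in the vocabulary of §1:** pointwise continuations along a level patch to a slab.
[cite: ONeill1983, Ch. 9, Lemma 9.28] -/
theorem landed_slabPatching {𝓑 : StationaryAFBlackHole.{0}} [𝓑.metric.HasLeviCivita] (hreg : 𝓑.IsIPlusRegular)
    {U' : Set 𝓑.carrier} {f : 𝓑.carrier → ℝ} {c₀ : ℝ} (hsweep : IsTimelikeSweep 𝓑 U' f c₀)
    {c : ℝ} (hc : c₀ ≤ c) {L : Π x : 𝓑.carrier, TangentSpace (𝓡 4) x}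
    (hL : IsLocalKilling 𝓑 (subLevel 𝓑 f c) L)
    (hpt : ∀ q ∈ 𝓑.doc, f q = c → PointContinuationAt 𝓑 (subLevel 𝓑 f c) L q) :
    ∃ ε : ℝ, 0 < ε ∧ ∃ L' : Π x : 𝓑.carrier, TangentSpace (𝓡 4) x,
      IsLocalKilling 𝓑 (subLevel 𝓑 f (c + ε)) L' ∧ ∀ x ∈ subLevel 𝓑 f c, L' x = L x :=
  Summit.FinalStateConjecture.FinalStateConjecture.Theorems.NonTrappingHawkingRigidity.AzimuthalPartialAnalyticity.stub_slabPatching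
    𝓑 hreg U' f c₀ hsweep c hc L hL hpt

end ReadBack

/-! ## §4 The composition, part 1 (sorry-free): Zorn on anchored partial continuations — VERBATIM the rev-8 §4
of `Lines/azimuthal_partial_analyticity.lean` (lead a1; rev-4 architecture of `Lines/Sketch.lean`). -/

section Composition

variable {𝓑 : StationaryAFBlackHole.{0}} [𝓑.metric.HasLeviCivita]
  {U' : Set 𝓑.carrier} {f : 𝓑.carrier → ℝ} {c₀ : ℝ}
  {K₀ : Π x : 𝓑.carrier, TangentSpace (𝓡 4) x}

variable (𝓑 U' f c₀ K₀) in
/-- An ANCHORED PARTIAL CONTINUATION of the sub-collar field `K₀` along the sweep `f`: a level `c ∈ [c₀, +∞]`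
(in `EReal`) and a local `T`-commuting Killing field `L` on `{f < c} ∩ doc` which equals `K₀` on the sub-collar
`U' ∩ doc`.  Level `⊤` means: `L` lives on the whole d.o.c. [folklore] -/
structure Cont where
  /-- the level reached -/
  c : EReal
  /-- the continued field (a global section; only its values on `{f < c} ∩ doc` matter) -/
  L : Π x : 𝓑.carrier, TangentSpace (𝓡 4) x
  /-- the level is at least the bottom level of the sweep -/
  hc : ((c₀ : ℝ) : EReal) ≤ c
  /-- `L` is a local `T`-commuting Killing field below the level -/
  killing : IsLocalKilling 𝓑 {x | x ∈ 𝓑.doc ∧ ((f x : ℝ) : EReal) < c} L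
  /-- `L` is anchored to the sub-collar field -/
  anchored : ∀ x ∈ U' ∩ 𝓑.doc, L x = K₀ x

/-- Partial continuations are ordered by EXTENSION. [folklore] -/
instance : Preorder (Cont 𝓑 U' f c₀ K₀) where
  le a b := a.c ≤ b.c ∧ ∀ x ∈ 𝓑.doc, ((f x : ℝ) : EReal) < a.c → b.L x = a.L x
  le_refl a := ⟨le_rfl, fun _ _ _ ↦ rfl⟩
  le_trans a b d hab hbd :=
    ⟨hab.1.trans hbd.1, fun x hx hlt ↦ (hbd.2 x hx (lt_of_lt_of_le hlt hab.1)).trans (hab.2 x hx hlt)⟩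

omit [𝓑.metric.HasLeviCivita] in
/-- Unfolding lemma for the extension order. [folklore] -/
theorem Cont.le_def [𝓑.metric.HasLeviCivita] {a b : Cont 𝓑 U' f c₀ K₀} :
    a ≤ b ↔ a.c ≤ b.c ∧ ∀ x ∈ 𝓑.doc, ((f x : ℝ) : EReal) < a.c → b.L x = a.L x := Iff.rfl

/-- For a real level the `EReal` domain of a partial continuation is the sub-level set. [folklore] -/
theorem setOf_ereal_lt_coe (c : ℝ) :
    {x | x ∈ 𝓑.doc ∧ ((f x : ℝ) : EReal) < (c : EReal)} = subLevel 𝓑 f c := by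
  ext x
  simp only [mem_setOf_eq, EReal.coe_lt_coe_iff, mem_subLevel]

/-- At level `⊤` the domain of a partial continuation is the whole d.o.c. [folklore] -/
theorem setOf_ereal_lt_top :
    {x | x ∈ 𝓑.doc ∧ ((f x : ℝ) : EReal) < (⊤ : EReal)} = 𝓑.doc := by
  ext x
  simp only [mem_setOf_eq, EReal.coe_lt_top, and_true]

/-- The `EReal`-domain of a level is open when `f` is continuous on the d.o.c. [folklore] -/
theorem isOpen_setOf_ereal_lt (hf : ContinuousOn f 𝓑.doc) (c : EReal) :
    IsOpen {x | x ∈ 𝓑.doc ∧ ((f x : ℝ) : EReal) < c} := by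
  have : {x | x ∈ 𝓑.doc ∧ ((f x : ℝ) : EReal) < c} = 𝓑.doc ∩ f ⁻¹' {r : ℝ | (r : EReal) < c} := by
    ext x; simp only [mem_setOf_eq, mem_inter_iff, mem_preimage]
  rw [this]
  exact hf.isOpen_inter_preimage (isOpen_doc 𝓑) (isOpen_Iio.preimage continuous_coe_real_ereal)

/-- **Chains of partial continuations have upper bounds** (the gluing step of Zorn). [folklore] -/
theorem Cont.bddAbove_of_isChain (hf : ContinuousOn f 𝓑.doc) (hbase : subLevel 𝓑 f c₀ = U' ∩ 𝓑.doc)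
    (hK₀ : IsLocalKilling 𝓑 (U' ∩ 𝓑.doc) K₀)
    (S : Set (Cont 𝓑 U' f c₀ K₀)) (hS : IsChain (· ≤ ·) S) : BddAbove S := by
  classical
  rcases S.eq_empty_or_nonempty with rfl | hne
  · refine ⟨⟨(c₀ : EReal), K₀, le_rfl, ?_, fun _ _ ↦ rfl⟩, fun _ h ↦ h.elim⟩
    rw [setOf_ereal_lt_coe, hbase]
    exact hK₀
  · let cs : EReal := sSup (Cont.c '' S)
    let Lg : Π x : 𝓑.carrier, TangentSpace (𝓡 4) x := fun x ↦
      if h : ∃ a ∈ S, ((f x : ℝ) : EReal) < a.c then h.choose.L x else K₀ x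
    have hagree : ∀ a ∈ S, ∀ b ∈ S, ∀ x ∈ 𝓑.doc,
        ((f x : ℝ) : EReal) < a.c → ((f x : ℝ) : EReal) < b.c → a.L x = b.L x := by
      intro a ha b hb x hx hxa hxb
      rcases hS.total ha hb with hab | hba
      · exact (hab.2 x hx hxa).symm
      · exact hba.2 x hx hxb
    have hLg : ∀ a ∈ S, ∀ x ∈ 𝓑.doc, ((f x : ℝ) : EReal) < a.c → Lg x = a.L x := by
      intro a ha x hx hxa
      have h : ∃ a ∈ S, ((f x : ℝ) : EReal) < a.c := ⟨a, ha, hxa⟩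
      simp only [Lg, dif_pos h]
      exact hagree _ h.choose_spec.1 a ha x hx h.choose_spec.2 hxa
    obtain ⟨a₀, ha₀⟩ := hne
    refine ⟨⟨cs, Lg, ?_, ?_, ?_⟩, ?_⟩
    · exact a₀.hc.trans (le_sSup (mem_image_of_mem Cont.c ha₀))
    · refine IsLocalKilling.of_locally fun x hx ↦ ?_
      obtain ⟨hxdoc, hxlt⟩ := hx
      obtain ⟨_, ⟨a, ha, rfl⟩, hxa⟩ := lt_sSup_iff.mp hxlt
      refine ⟨{y | y ∈ 𝓑.doc ∧ ((f y : ℝ) : EReal) < a.c}, a.L, isOpen_setOf_ereal_lt hf a.c,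
        ⟨hxdoc, hxa⟩, a.killing, fun y hy ↦ hLg a ha y hy.1 hy.2⟩
    · intro x hx
      have hx' : x ∈ subLevel 𝓑 f c₀ := hbase ▸ hx
      have hlt : ((f x : ℝ) : EReal) < a₀.c :=
        lt_of_lt_of_le (EReal.coe_lt_coe_iff.mpr hx'.2) a₀.hc
      rw [hLg a₀ ha₀ x hx.2 hlt]
      exact a₀.anchored x hx
    · intro a ha
      exact ⟨le_sSup (mem_image_of_mem Cont.c ha), fun x hx hxa ↦ hLg a ha x hx hxa⟩

end Composition

/-! ## §5 The composition, part 2: sweep datum and the skeleton theorem -/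

/-- **From a radial function with spacelike gradient on the closed ergoregion to the timelike sweep** (verbatim
the live line's `sweep_of_radial`, wave-2 worker W5). [folklore] -/
theorem sweep_of_radial (𝓑 : StationaryAFBlackHole.{0}) {ρ : 𝓑.carrier → ℝ} (hρ : IsInvariantRadialFunction 𝓑 ρ)
    (hergo : ∀ x ∈ 𝓑.doc, 0 ≤ 𝓑.metric.val x (𝓑.killing x) (𝓑.killing x) →
      ∃ w : TangentSpace (𝓡 4) x, 0 < 𝓑.metric.val x w w ∧
        ∀ u : TangentSpace (𝓡 4) x, mfderiv (𝓡 4) 𝓘(ℝ, ℝ) ρ x u = 𝓑.metric.val x w u)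
    (U₁ : Set 𝓑.carrier) (hU₁ : IsOpen U₁) (hHU₁ : 𝓑.horizon ⊆ U₁)
    (hinv : ∀ γ : ℝ → 𝓑.carrier, IsMIntegralCurve γ 𝓑.killing → γ 0 ∈ U₁ ∩ 𝓑.doc →
      ∀ t, γ t ∈ U₁ ∩ 𝓑.doc) :
    ∃ (U' : Set 𝓑.carrier) (c₀ : ℝ),
      IsOpen U' ∧ 𝓑.horizon ⊆ U' ∧ U' ∩ 𝓑.doc ⊆ U₁ ∧ IsTimelikeSweep 𝓑 U' ρ c₀ := by
  obtain ⟨hρs, hρT, hρreg, hadj, hthin, hslab⟩ := hρ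
  obtain ⟨c₀, hc₀, hsub⟩ := hthin U₁ hU₁ hHU₁ hinv
  obtain ⟨U', hU'o, hU'H, hU'eq⟩ := hadj c₀ hc₀
  refine ⟨U', c₀, hU'o, hU'H, ?_, hρs, hρT, hU'eq.symm, ?_, fun c ↦ hslab c₀ c hc₀⟩
  · rw [hU'eq]; exact hsub
  · intro x hx _
    by_cases hTT : 0 ≤ 𝓑.metric.val x (𝓑.killing x) (𝓑.killing x)
    · exact hergo x hx hTT
    · exact 𝓑.metric.exists_pos_val_and_mfderiv_eq_val (T := 𝓑.killing) (not_le.mp hTT)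
        (hρT x hx) (hρreg x hx)

/-- **Sub-collar, timelike sweep and docking datum** (the live line's `collarSweep_of` with the LANDED S1a called
by name). [folklore] -/
theorem collarSweep_of (hCC : chruscielCosta2008_equivariantTimeFunction)
    {𝓑 : StationaryAFBlackHole.{0}} [𝓑.metric.HasLeviCivita]
    {U : Set 𝓑.carrier} {K : Π x : 𝓑.carrier, TangentSpace (𝓡 4) x}
    (hvac : 𝓑.metric.toPseudoRiemannianMetric.IsRicciFlat) (hreg : 𝓑.IsIPlusRegular)
    (hfp : ∀ p : 𝓑.carrier, p ∈ 𝓑.metric.chronologicalFuture 𝓑.timeOrientation 𝓑.Mext)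
    (hT : ∀ p ∈ 𝓑.doc, 𝓑.killing p ≠ 0) (hsc : SimplyConnectedSpace 𝓑.doc)
    (hcol : IsKillingTimelikeCollar 𝓑 U K) (hbelt : BeltCompactModFlow 𝓑 U)
    (hnt : NoTrappedGeodesicModFlow 𝓑) {ρ : 𝓑.carrier → ℝ} (hρ : IsInvariantRadialFunction 𝓑 ρ)
    (hergo : ∀ x ∈ 𝓑.doc, 0 ≤ 𝓑.metric.val x (𝓑.killing x) (𝓑.killing x) →
      ∃ w : TangentSpace (𝓡 4) x, 0 < 𝓑.metric.val x w w ∧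
        ∀ u : TangentSpace (𝓡 4) x, mfderiv (𝓡 4) 𝓘(ℝ, ℝ) ρ x u = 𝓑.metric.val x w u) :
    ∃ (U' : Set 𝓑.carrier) (c₀ : ℝ) (K₀ : Π x : 𝓑.carrier, TangentSpace (𝓡 4) x),
      IsOpen U' ∧ 𝓑.horizon ⊆ U' ∧ IsTimelikeSweep 𝓑 U' ρ c₀ ∧ IsLocalKilling 𝓑 (U' ∩ 𝓑.doc) K₀ ∧
      ∃ U'' : Set 𝓑.carrier, IsOpen U'' ∧ 𝓑.horizon ⊆ U'' ∧ ∀ x ∈ U'' ∩ 𝓑.doc, K₀ x = K x := by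
  obtain ⟨U₁, V, U'', K₁, hU₁, hHU₁, hinv, hV, hHV, hVU, hVU₁, hK₁, hU'', hHU'', hdock⟩ :=
    landed_invariantKillingSubcollar hCC hvac hreg hfp hT hsc hcol hbelt hnt
  obtain ⟨U', c₀, hU', hHU', hU'U₁, hsweep⟩ := sweep_of_radial 𝓑 hρ hergo U₁ hU₁ hHU₁ hinv
  have hsub : U' ∩ 𝓑.doc ⊆ U₁ ∩ 𝓑.doc := fun x hx ↦ ⟨hU'U₁ hx, hx.2⟩
  exact ⟨U', c₀, K₁, hU', hHU', hsweep, hK₁.mono hsub, U'', hU'', hHU'', hdock⟩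

/-- **`NonTrappingHawkingRigidity_of` — THE SKELETON of line `zero-energy-convex-sweep` (registered stubs ⇒ the
crux BY NAME; 3 open — G1, S2c, D′; four LANDED stubs called by name — S1a, S1b₇, S2a, S3).**  D′ supplies the
four named facts; S1b₇ the structural `ρ₀`; G1 the radial function `f` with spacelike gradient on the closed
ergoregion and strict `T`-null-convexity at belt points; S1a + `sweep_of_radial` the anchored sub-collar field and
the timelike sweep; then the Zorn argument: a maximal anchored partial continuation of finite level `c` would be
strictly extended — every level point is supported through a NON-NULL level (spacelike gradient), and continued
one step by S2a (MzH analyticity + local Nomizu) where `T` is timelike or on `U`, by S2c (IK `T`-conditional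
Carleman) at belt points off `U` (`T`-invariance of `f` on the open d.o.c., convexity from G1) —, S3 patches to
`{f < c + ε}`; so the maximal level is `⊤` and its field docks to `K` on `U' ∩ U''`. [folklore] -/
theorem NonTrappingHawkingRigidity_of (hG1 : stub_convexRadialFunction)
    (hC : stub_conditionalCarlemanContinuation) (hD : stub_carlemanLineDebts) : NonTrappingHawkingRigidity := by
  intro 𝓑 _ hvac hreg hfp h4 hsc U K hU hHU hconn hsm hkil hcomm hne htan htl hbelt hnt
  have hcol : IsKillingTimelikeCollar 𝓑 U K := ⟨hU, hHU, hconn, ⟨hsm, hkil, hcomm⟩, hne, htan, htl⟩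
  obtain ⟨hCC, hMzH, hDPS, hIK⟩ := (id hD : type_of% Holds.stub_carlemanLineDebts)
  -- Nomizu's extension theorem is a THEOREM of the tree (discharged named fact)
  have hNo : PseudoRiemannianMetric.Nomizu1960_killing_extension :=
    PseudoRiemannianMetric.Nomizu1960_killing_extension_holds
  -- structure of the d.o.c. (S1b₇, LANDED): a radial function `ρ₀` with (R1)–(R6)
  obtain ⟨ρ₀, hρ₀⟩ := landed_invariantRadialFunction hDPS hvac hreg hfp h4 hsc hconn
  -- G1: the convex radial function `f`
  obtain ⟨f, hρ, hergo, hconv⟩ :=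
    stub_convexRadialFunction_iff.mp hG1 𝓑 U K hvac hreg hfp h4 hsc hcol hbelt hnt ρ₀ hρ₀
  -- the anchored sub-collar field and the timelike sweep along `f`
  obtain ⟨U', c₀, K₀, hU'o, hHU', ⟨hfs, hfT, hbase, hgrad, hproper⟩, hK₀', U'', hU''o, hHU'', hdock⟩ :=
    collarSweep_of hCC hvac hreg hfp h4 hsc hcol hbelt hnt hρ hergo
  -- FULL chartwise analyticity where `T` is timelike or on the collar (MzH applied to `(univ, T)` / `(U, K)`)
  have hAn : ∀ q ∈ 𝓑.doc, (𝓑.metric.val q (𝓑.killing q) (𝓑.killing q) < 0 ∨ q ∈ U) →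
      𝓑.IsChartwiseAnalyticAt q := by
    intro q hq hqU
    rcases hqU with hTq | hqU
    · have hKF := 𝓑.isStationaryKilling.isKillingField
      obtain ⟨ψ₀, hψ₀, hqψ₀, hG₀⟩ := hMzH 𝓑 hvac Set.univ 𝓑.killing isOpen_univ
        hKF.contMDiff.contMDiffOn (fun x _ v w ↦ hKF.val_leviCivita_add x v w) q (mem_univ q) hTq
      exact ⟨ψ₀, hψ₀, hqψ₀, hG₀⟩
    · obtain ⟨ψ₀, hψ₀, hqψ₀, hG₀⟩ := hMzH 𝓑 hvac U K hU hsm hkil q hqU (htl q ⟨hqU, hq⟩)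
      exact ⟨ψ₀, hψ₀, hqψ₀, hG₀⟩
  have hfc : ContinuousOn f 𝓑.doc := hfs.continuousOn
  -- `f` is `T`-invariant on the OPEN d.o.c.: the local invariance hypothesis of S2c at every point of doc
  have hfTloc : ∀ q ∈ 𝓑.doc, ∃ N' : Set 𝓑.carrier, IsOpen N' ∧ q ∈ N' ∧
      ∀ x ∈ N', mfderiv (𝓡 4) 𝓘(ℝ, ℝ) f x (𝓑.killing x) = 0 :=
    fun q hq ↦ ⟨𝓑.doc, isOpen_doc 𝓑, hq, hfT⟩
  -- the step: a partial continuation of finite level is strictly extended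
  have step : ∀ a : Cont 𝓑 U' f c₀ K₀, a.c ≠ ⊤ → ∃ b : Cont 𝓑 U' f c₀ K₀, a ≤ b ∧ a.c < b.c := by
    intro a hatop
    have habot : a.c ≠ ⊥ := ne_bot_of_le_ne_bot (EReal.coe_ne_bot c₀) a.hc
    set c : ℝ := a.c.toReal with hcdef
    have hac : a.c = (c : EReal) := (EReal.coe_toReal hatop habot).symm
    have hc₀c : c₀ ≤ c := by
      have := a.hc; rw [hac] at this; exact EReal.coe_le_coe_iff.mp this
    have hdom : {x | x ∈ 𝓑.doc ∧ ((f x : ℝ) : EReal) < a.c} = subLevel 𝓑 f c := by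
      rw [hac]; exact setOf_ereal_lt_coe c
    have hL : IsLocalKilling 𝓑 (subLevel 𝓑 f c) a.L := hdom ▸ a.killing
    -- pointwise continuations along the level `{f = c}`
    have hpt : ∀ q ∈ 𝓑.doc, f q = c → PointContinuationAt 𝓑 (subLevel 𝓑 f c) a.L q := by
      intro q hq hfq
      have hsupp : NonNullSupportAt 𝓑 (subLevel 𝓑 f c) q f := by
        obtain ⟨w, hw, hdw⟩ := hgrad q hq (hfq ▸ hc₀c)
        refine ⟨𝓑.doc, isOpen_doc 𝓑, hq, hfs, ⟨w, ne_of_gt hw, hdw⟩, ?_⟩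
        intro x hx
        rw [hfq]
        exact ⟨fun h ↦ h.2, fun hlt ↦ ⟨hx.2, hlt⟩⟩
      by_cases hreg' : 𝓑.metric.val q (𝓑.killing q) (𝓑.killing q) < 0 ∨ q ∈ U
      · -- `T`-timelike or collar point: full analyticity (MzH) + local Nomizu (S2a, LANDED)
        exact landed_pointContinuationAnalytic hNo (isOpen_subLevel hfc c) (subLevel_subset_doc f c) hL hq
          hsupp (hAn q hq hreg')
      · -- belt point off `U`: strict `T`-null-convexity from G1 + the `T`-conditional Carleman lever (S2c)
        simp only [not_or, not_lt] at hreg'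
        exact stub_conditionalCarlemanContinuation_iff.mp hC hIK 𝓑 hvac h4 (subLevel 𝓑 f c) a.L
          (isOpen_subLevel hfc c) (subLevel_subset_doc f c) hL q hq f hsupp (hfTloc q hq)
          (hconv q hq hreg'.1 hreg'.2)
    obtain ⟨ε, hε, L', hL', hext⟩ :=
      landed_slabPatching hreg ⟨hfs, hfT, hbase, hgrad, hproper⟩ hc₀c hL hpt
    have hL'' : IsLocalKilling 𝓑 (subLevel 𝓑 f (c + ε)) L' := hL'
    refine ⟨⟨((c + ε : ℝ) : EReal), L', ?_, ?_, ?_⟩, ?_, ?_⟩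
    · exact EReal.coe_le_coe_iff.mpr (hc₀c.trans (le_add_of_nonneg_right hε.le))
    · rw [setOf_ereal_lt_coe]; exact hL''
    · intro x hx
      have hx' : x ∈ subLevel 𝓑 f c := subLevel_mono f hc₀c (hbase ▸ hx : x ∈ subLevel 𝓑 f c₀)
      rw [hext x hx']
      exact a.anchored x hx
    · refine ⟨?_, fun x hx hlt ↦ ?_⟩
      · show a.c ≤ ((c + ε : ℝ) : EReal)
        rw [hac]; exact EReal.coe_le_coe_iff.mpr (le_add_of_nonneg_right hε.le)
      · rw [hac] at hlt
        exact hext x ⟨hx, EReal.coe_lt_coe_iff.mp hlt⟩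
    · show a.c < ((c + ε : ℝ) : EReal)
      rw [hac]; exact EReal.coe_lt_coe_iff.mpr (lt_add_of_pos_right c hε)
  -- Zorn
  obtain ⟨m, hm⟩ : ∃ m : Cont 𝓑 U' f c₀ K₀, IsMax m :=
    zorn_le (fun S hS ↦ Cont.bddAbove_of_isChain hfc hbase hK₀' S hS)
  have hmtop : m.c = ⊤ := by
    by_contra hne'
    obtain ⟨b, hmb, hlt⟩ := step m hne'
    exact (lt_irrefl m.c) (lt_of_lt_of_le hlt (hm hmb).1)
  have hKill : IsLocalKilling 𝓑 𝓑.doc m.L := by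
    have := m.killing
    rw [hmtop, setOf_ereal_lt_top] at this
    exact this
  refine ⟨m.L, hKill.1, hKill.2.1, hKill.2.2, U' ∩ U'', hU'o.inter hU''o, subset_inter hHU' hHU'', ?_⟩
  rintro x ⟨⟨hxU', hxU''⟩, hxdoc⟩
  rw [m.anchored x ⟨hxU', hxdoc⟩]
  exact hdock x ⟨hxU'', hxdoc⟩

/-- D-0027 §3.3: the crux from the registered stubs themselves (sorry-tainted through the three stubs until they
are discharged; credits nothing). -/
theorem NonTrappingHawkingRigidity_proof : NonTrappingHawkingRigidity :=
  NonTrappingHawkingRigidity_of Holds.stub_convexRadialFunction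
    Holds.stub_conditionalCarlemanContinuation Holds.stub_carlemanLineDebts

/-- The two routes wanting the crux type it with letter-identical bodies: the skeleton closes the
`AnalyticityInvadesErgoregion` copy definitionally as well. [folklore] -/
theorem NonTrappingHawkingRigidity_of' (hG1 : stub_convexRadialFunction)
    (hC : stub_conditionalCarlemanContinuation) (hD : stub_carlemanLineDebts) :
    Summit.FinalStateConjecture.FinalStateConjecture.Theses.AnalyticityInvadesErgoregion.NonTrappingHawkingRigidity :=
  NonTrappingHawkingRigidity_of hG1 hC hD

/-! ## §6 Scratch certificates (kernel): the bet G1 holds on Kerr; no stub is the Negative lemma's instance -/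

/-- **G1's convexity clause (C2) on every sub-extremal Kerr–Schild Kerr exterior, for `ρ = r` (tree theorem,
re-exported here as the line's anti-vacuity / first-rung certificate):** at every point beyond the outer horizon a
non-zero null vector orthogonal to `∂_t` and tangent to `{r = c}` has negative covariant Hessian of `r`.
[cite: IonescuKlainerman2009, §3.1 (HoCond2)] -/
example : ∀ {M a : ℝ}, 0 < M → |a| ≤ M → ∀ {z : E4}, Kerr.rPlus M a < Kerr.radius a z →
    ∀ {X : E4}, X ≠ 0 → Kerr.bilin M a z X X = 0 → fderiv ℝ (Kerr.radius a) z X = 0 →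
      Kerr.bilin M a z (E4.basisVector 0) X = 0 →
      Literature.Geometry.Lorentzian.MetricCoord.hessAt (Kerr.bilin M a) (Kerr.radius a) z X X < 0 :=
  fun hM ha _ hr _ hX hnull hdr hT ↦ Kerr.hessAt_radius_neg_of_bilin_basisVector_zero hM ha hr hX hnull hdr hT

/-- Scratch check against the landed Negative lemma (Disproof F1): the crux is equivalent to itself minus h4; this
line USES h4 (S2c) but files no stub of that shape. -/
example := Summit.FinalStateConjecture.FinalStateConjecture.Theorems.NonTrappingHawkingRigidity.Negative.nonTrappingHawkingRigidity_iff_withoutH4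

end Summit.FinalStateConjecture.FinalStateConjecture.Cruxes.NonTrappingHawkingRigidity.ZeroEnergyConvexSweep

end
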